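import Summits.HodgeConjecture.HodgeConjecture.Theorems.F0P3cStCharTSHCDCayleyChartAt   -- (D6a)+(D6c) (this seat): `exists_depth_lintegral_translate_eq`
import Literature.LinearAlgebra.Matrix.CayleyCharpolyDiscr                                -- ★ D6(b) p851997 (F0P2-p06): `discr_charpoly_cayley_mul_det_sq`, `charpoly_coeff_fin_three`
import Literature.LinearAlgebra.Matrix.RegularSemisimpleConjClassClosed                   -- ★ `continuous_charpoly_coeff`
import Literature.NumberTheory.Automorphic.LocalFieldHaarBalls                            -- ★ `LocalFieldHaar.continuous_normAbs`
import Mathlib.MeasureTheory.Measure.Haar.MulEquivHaarChar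
import Mathlib.Topology.Algebra.Ring.Real
import HarnessLib

/-!
# F0 · P3c · line LH6 «StCharTS» — ROAD «HC-D» step (G→𝔤): LOCAL INTEGRABILITY OF `|D_G|^{−1∕2}` ON THE GROUP FOLLOWS FROM LOCAL INTEGRABILITY
# OF `|η|^{−1∕4}` ON THE LIE ALGEBRA (`3 × 3`, through the translated Cayley chart of ★ `F0P3cStCharTSHCDCayleyChartAt`)

Cell `pub/hodgecm-mathlib`, crux H413 = `stmt-HodgeConjecture-24833` (lane `--supports … --as helper`); seat F0P3a-p06 (g21); ROAD «HC-D» (holder ∕ dealer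
F0P2-p01 (g23)), bricks (D6a)+(D6c), consumer side in the road's tokens R2: on the Lie algebra the integrand is
`ηι X := (↑√√(normAbs K (discr χ_X)))⁻¹ ∈ [0, ∞]`, on the group `θ M := (↑√√(normAbs K (discr χ_M) · (normAbs K (det M))⁻²))⁻¹` — the one-place reading of
RUNG0's `hDGliO` integrand `|D_G|^{−1∕2}` ([HarishChandra1970] Part VII §1 Thm. 15, the printed statement being paid down).  THEOREMS ONLY; sorry-free; no
definition ∕ instance ∕ notation; `m = Fin 3` (the discriminant algebra of ★ D6(b) is cubic).

THE MATHEMATICS.  §1 The Weyl ratio `|discr χ_M|·|det M|⁻²` is invariant under non-zero scalars (`discr χ_{zM} = z⁶ discr χ_M`, `det(zM) = z³ det M`) and reads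
through the Cayley map as `|2|⁶ |discr χ_X| ∕ |det(1−X) det(1+X)|²` (★ D6(b) `discr_charpoly_cayley_mul_det_sq`); hence (§2, `ℝ≥0∞` bookkeeping)
**`θ(z • c(X)) ≤ C(X) · ηι(X)`**, `C(X) = √|det(1−X)det(1+X)| ∕ (√|2|)³`.  §3 `g ↦ θ(ρ g)` is continuous on `G`; `s ↦ θ(z • c(X₀ + s))` is Borel on `𝔲`
(continuous where `1 ± (X₀ + s)` are invertible, `≡ ⊤` elsewhere).  §4 HEAD **`exists_nhds_setLIntegral_theta_lt_top`**: if every point of `𝔲` has a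
neighbourhood on which `ηι` is `μ`-integrable, then every `g₀ ∈ G` has a neighbourhood on which `θ ∘ ρ` is `ν`-integrable — by ★ `exists_depth_lintegral_translate_eq`
(`∫_U θ(ρ g) dν = κ ∫_{Λ_k} θ(z • c(X₀ + L̃ Y)) dμ`), §2, the bound `C ≤ C*` on the compact `Λ_k`, and the change of variables `Y ↦ X₀ + L̃ Y` (translation invariance +
Mathlib `addEquivAddHaarChar`), after shrinking `Λ_k` into the given neighbourhood of `X₀`.  D7 (F0P2-p01) turns this into `hDGliO` on `Gqs L v`.
HONEST LABEL: count-neutral; closes no organ; HC_CM is proved only modulo the 7 printed citations (2 remaining: hLiu418 = `stmt-HodgeConjecture-24832`,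
h413 = `stmt-HodgeConjecture-24833`) until rung 0 closes.

## References
* [HarishChandra1970] Harish-Chandra, *Harmonic analysis on reductive p-adic groups*, LNM 162 (1970), Part VII §1 Thm. 15.
* [Rogawski1990] J. D. Rogawski, *Automorphic Representations of Unitary Groups in Three Variables* (1990), §4.9 p. 54 (`D_G`), §12.5 p. 182.
* [PlatonovRapinchuk1994] V. Platonov, A. Rapinchuk, *Algebraic Groups and Number Theory* (1994), §3.3.
-/

set_option autoImplicit false
set_option linter.dupNamespace false

noncomputable section

open Set Filter MeasureTheory MeasureTheory.Measure TopologicalSpace Topology Matrix ValuativeRel Metric Polynomial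
open Literature.NumberTheory.Automorphic Literature.NumberTheory.Weil1982.UnitaryFinTopForm Literature.LinearAlgebra.Matrix
open Literature.NumberTheory.GaloisRepresentations.IsNonarchimedeanLocalField
open Summit.HodgeConjecture.HodgeConjecture.Cruxes.H413.F0P3cStCharTSHCDCayleyChartAt
open scoped Pointwise Topology ENNReal NNReal MatrixGroups

namespace Summit.HodgeConjecture.HodgeConjecture.Cruxes.H413.F0P3cStCharTSHCDGroupToLie

/-! ## §1 The Weyl ratio: scalar invariance and the Cayley reading -/

section Ring

variable {R : Type*} [CommRing R]

/-- **Homogeneity of the cubic discriminant**: `discr χ_{cM} = c⁶ · discr χ_M` for a `3 × 3` matrix (coefficients scale by `c, c², c³`; Mathlib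
`discr_of_degree_eq_three`). [cite: Rogawski1990, §4.9 p. 54] -/
theorem discr_charpoly_smul_fin_three (c : R) (M : Matrix (Fin 3) (Fin 3) R) :
    (c • M).charpoly.discr = c ^ 6 * M.charpoly.discr := by
  nontriviality R
  have hdeg : ∀ N : Matrix (Fin 3) (Fin 3) R, N.charpoly.degree = 3 := fun N => by
    rw [Matrix.charpoly_degree_eq_dim]; rfl
  obtain ⟨h3, h2, h1, h0⟩ := charpoly_coeff_fin_three (c • M)
  obtain ⟨g3, g2, g1, g0⟩ := charpoly_coeff_fin_three M
  rw [discr_of_degree_eq_three (hdeg _), discr_of_degree_eq_three (hdeg _), h3, h2, h1, h0, g3, g2, g1, g0]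
  simp only [Matrix.smul_apply, smul_eq_mul]
  ring

end Ring

section Field

variable {K : Type*} [Field K] [ValuativeRel K] [TopologicalSpace K] [IsNonarchimedeanLocalField K]

/-- **The Weyl ratio `|discr χ_M| · |det M|⁻²` is invariant under non-zero scalars** (`3 × 3`: both scale by `|z|⁶`). [cite: Rogawski1990, §4.9 p. 54] -/
theorem weylRatio_smul {z : K} (hz : z ≠ 0) (M : Matrix (Fin 3) (Fin 3) K) :
    normAbs K (z • M).charpoly.discr * ((normAbs K (z • M).det) ^ 2)⁻¹ = normAbs K M.charpoly.discr * ((normAbs K M.det) ^ 2)⁻¹ := by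
  rw [discr_charpoly_smul_fin_three, Matrix.det_smul, Fintype.card_fin, map_mul, map_mul, map_pow, map_pow]
  have hN : normAbs K z ≠ 0 := (map_ne_zero (normAbs K)).2 hz
  rw [mul_pow, ← pow_mul, show 3 * 2 = 6 by norm_num, mul_inv, ← mul_assoc, mul_comm (normAbs K z ^ 6), mul_assoc (normAbs K M.charpoly.discr),
    mul_inv_cancel₀ (pow_ne_zero _ hN), mul_one]

/-- **The Weyl ratio through the Cayley map** (★ D6(b)): for `1 ± X` invertible,
`(|discr χ_{c X}| · |det c X|⁻²) · |det(1−X) det(1+X)|² = |2|⁶ · |discr χ_X|`, `c X = (1 + X)(1 − X)⁻¹`. [cite: PlatonovRapinchuk1994, §3.3] [cite: Rogawski1990, §4.9 p. 54] -/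
theorem weylRatio_cayley_mul {X : Matrix (Fin 3) (Fin 3) K} (hm : IsUnit (1 - X).det) (hp : IsUnit (1 + X).det) :
    normAbs K (cayley X).charpoly.discr * ((normAbs K (cayley X).det) ^ 2)⁻¹ * (normAbs K ((1 - X).det * (1 + X).det)) ^ 2 =
      (normAbs K 2) ^ 6 * normAbs K X.charpoly.discr := by
  have hdet : (cayley X).det ≠ 0 := by
    rw [cayley_def, Matrix.det_mul, Matrix.det_nonsing_inv, Ring.inverse_eq_inv']
    exact mul_ne_zero hp.ne_zero (inv_ne_zero hm.ne_zero)
  have hNd : normAbs K (cayley X).det ≠ 0 := (map_ne_zero (normAbs K)).2 hdet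
  have key := congrArg (normAbs K) (discr_charpoly_cayley_mul_det_sq X hm)
  rw [← cayley_def] at key
  simp only [map_mul, map_pow] at key
  have key' : normAbs K (cayley X).charpoly.discr * (normAbs K ((1 - X).det * (1 + X).det)) ^ 2 =
      (normAbs K 2) ^ 6 * normAbs K X.charpoly.discr * (normAbs K (cayley X).det) ^ 2 := by
    rw [map_mul]; simpa [mul_pow] using key
  calc normAbs K (cayley X).charpoly.discr * ((normAbs K (cayley X).det) ^ 2)⁻¹ * (normAbs K ((1 - X).det * (1 + X).det)) ^ 2
      = normAbs K (cayley X).charpoly.discr * (normAbs K ((1 - X).det * (1 + X).det)) ^ 2 * ((normAbs K (cayley X).det) ^ 2)⁻¹ := by ring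
    _ = (normAbs K 2) ^ 6 * normAbs K X.charpoly.discr * (normAbs K (cayley X).det) ^ 2 * ((normAbs K (cayley X).det) ^ 2)⁻¹ := by rw [key']
    _ = (normAbs K 2) ^ 6 * normAbs K X.charpoly.discr := by rw [mul_assoc, mul_inv_cancel₀ (pow_ne_zero _ hNd), mul_one]

end Field

/-! ## §2 `ℝ≥0∞` bookkeeping: `θ(z • c X) ≤ C(X) · ηι(X)` -/

section Bound

/-- `√√u · √p = (√t)³ · √√a` from `u · p² = t⁶ · a` in `ℝ≥0`. [cite: Rogawski1990, §4.9 p. 54] -/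
theorem sqrt_sqrt_mul_sqrt_eq {u p t a : ℝ≥0} (h : u * p ^ 2 = t ^ 6 * a) :
    NNReal.sqrt (NNReal.sqrt u) * NNReal.sqrt p = NNReal.sqrt t ^ 3 * NNReal.sqrt (NNReal.sqrt a) := by
  have h1 : NNReal.sqrt u * p = t ^ 3 * NNReal.sqrt a := by
    have : NNReal.sqrt (u * p ^ 2) = NNReal.sqrt (t ^ 6 * a) := by rw [h]
    rwa [NNReal.sqrt_mul, NNReal.sqrt_mul, NNReal.sqrt_sq, show t ^ 6 = (t ^ 3) ^ 2 by ring, NNReal.sqrt_sq] at this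
  have h2 : NNReal.sqrt (NNReal.sqrt u * p) = NNReal.sqrt (t ^ 3 * NNReal.sqrt a) := by rw [h1]
  rw [NNReal.sqrt_mul, NNReal.sqrt_mul] at h2
  rw [h2]
  congr 1
  rw [NNReal.sqrt_eq_iff_eq_sq, ← pow_mul, show 3 * 2 = 6 by norm_num, show NNReal.sqrt t ^ 6 = (NNReal.sqrt t ^ 2) ^ 3 by ring,
    NNReal.sq_sqrt]

/-- `(√√u)⁻¹ ≤ (√p ∕ (√t)³) · (√√a)⁻¹` in `[0, ∞]` (the case `a = 0` being `⊤ = ⊤`), for `u · p² = t⁶ · a`, `p, t ≠ 0`. [cite: Rogawski1990, §4.9 p. 54] -/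
theorem inv_sqrt_sqrt_le {u p t a : ℝ≥0} (h : u * p ^ 2 = t ^ 6 * a) (hp : p ≠ 0) (ht : t ≠ 0) :
    ((NNReal.sqrt (NNReal.sqrt u) : ℝ≥0∞))⁻¹ ≤ (NNReal.sqrt p / NNReal.sqrt t ^ 3 : ℝ≥0) * ((NNReal.sqrt (NNReal.sqrt a) : ℝ≥0∞))⁻¹ := by
  have hsp : NNReal.sqrt p ≠ 0 := by rwa [ne_eq, NNReal.sqrt_eq_zero]
  have hst : NNReal.sqrt t ^ 3 ≠ 0 := pow_ne_zero _ (by rwa [ne_eq, NNReal.sqrt_eq_zero])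
  by_cases ha : a = 0
  · subst ha
    rw [NNReal.sqrt_zero, NNReal.sqrt_zero, ENNReal.coe_zero, ENNReal.inv_zero, ENNReal.mul_top (by exact_mod_cast div_ne_zero hsp hst)]
    exact le_top
  have hsa : NNReal.sqrt (NNReal.sqrt a) ≠ 0 := by rwa [ne_eq, NNReal.sqrt_eq_zero, NNReal.sqrt_eq_zero]
  have hS := sqrt_sqrt_mul_sqrt_eq h
  have hSu : NNReal.sqrt (NNReal.sqrt u) = NNReal.sqrt t ^ 3 * NNReal.sqrt (NNReal.sqrt a) / NNReal.sqrt p := by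
    rw [eq_div_iff hsp, hS]
  have hSu0 : NNReal.sqrt (NNReal.sqrt u) ≠ 0 := by rw [hSu]; exact div_ne_zero (mul_ne_zero hst hsa) hsp
  rw [← ENNReal.coe_inv hSu0, ← ENNReal.coe_inv hsa, ← ENNReal.coe_mul, ENNReal.coe_le_coe, hSu]
  rw [inv_div, div_eq_mul_inv, mul_inv, div_eq_mul_inv]
  rw [mul_comm (NNReal.sqrt p), mul_assoc, mul_comm]
  ring_nf
  exact le_rfl

variable {K : Type*} [Field K] [ValuativeRel K] [TopologicalSpace K] [IsNonarchimedeanLocalField K]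

/-- **`θ(z • c X) ≤ C(X) · ηι(X)`**: for `z ≠ 0` and `1 ± X` invertible,
`(↑√√(|discr χ_M|·|det M|⁻²))⁻¹ ≤ (√|det(1−X)det(1+X)| ∕ (√|2|)³) · (↑√√|discr χ_X|)⁻¹` with `M = z • c(X)` (§1 + `inv_sqrt_sqrt_le`; `2 ≠ 0`).
[cite: Rogawski1990, §4.9 p. 54] [cite: PlatonovRapinchuk1994, §3.3] -/
theorem theta_smul_cayley_le (h2 : (2 : K) ≠ 0) {z : K} (hz : z ≠ 0) {X : Matrix (Fin 3) (Fin 3) K} (hm : IsUnit (1 - X).det)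
    (hp : IsUnit (1 + X).det) :
    ((NNReal.sqrt (NNReal.sqrt (normAbs K (z • cayley X).charpoly.discr * ((normAbs K (z • cayley X).det) ^ 2)⁻¹)) : ℝ≥0) : ℝ≥0∞)⁻¹ ≤
      ((NNReal.sqrt (normAbs K ((1 - X).det * (1 + X).det)) / NNReal.sqrt (normAbs K 2) ^ 3 : ℝ≥0) : ℝ≥0∞) *
        ((NNReal.sqrt (NNReal.sqrt (normAbs K X.charpoly.discr)) : ℝ≥0) : ℝ≥0∞)⁻¹ := by
  rw [weylRatio_smul hz]
  exact inv_sqrt_sqrt_le (weylRatio_cayley_mul hm hp) ((map_ne_zero (normAbs K)).2 (mul_ne_zero hm.ne_zero hp.ne_zero))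
    ((map_ne_zero (normAbs K)).2 h2)

end Bound

/-! ## §3 Continuity ∕ measurability of the two integrands -/

section Measurable

variable {K : Type*} [Field K] [ValuativeRel K] [TopologicalSpace K] [IsNonarchimedeanLocalField K]

/-- `M ↦ discr χ_M` is continuous on `3 × 3` matrices (a polynomial in the coefficients, ★ `continuous_charpoly_coeff`). [cite: Rogawski1990, §4.9 p. 54] -/
theorem continuous_discr_charpoly : Continuous fun M : Matrix (Fin 3) (Fin 3) K => M.charpoly.discr := by
  have hc : ∀ i : ℕ, Continuous fun M : Matrix (Fin 3) (Fin 3) K => M.charpoly.coeff i := fun i => continuous_charpoly_coeff i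
  have heq : (fun M : Matrix (Fin 3) (Fin 3) K => M.charpoly.discr) = fun M : Matrix (Fin 3) (Fin 3) K =>
      M.charpoly.coeff 2 ^ 2 * M.charpoly.coeff 1 ^ 2 - 4 * M.charpoly.coeff 3 * M.charpoly.coeff 1 ^ 3 - 4 * M.charpoly.coeff 2 ^ 3 * M.charpoly.coeff 0
        - 27 * M.charpoly.coeff 3 ^ 2 * M.charpoly.coeff 0 ^ 2 + 18 * M.charpoly.coeff 3 * M.charpoly.coeff 2 * M.charpoly.coeff 1 * M.charpoly.coeff 0 := by
    funext M
    nontriviality K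
    exact discr_of_degree_eq_three (by rw [Matrix.charpoly_degree_eq_dim]; rfl)
  rw [heq]
  fun_prop

/-- **`θ` is continuous at matrices with non-zero determinant** (`ℝ≥0∞`-valued; `x ↦ x⁻¹` is continuous on `ℝ≥0` away from `0` and on `[0, ∞]` everywhere).
[cite: Rogawski1990, §4.9 p. 54] -/
theorem continuousAt_theta {M : Matrix (Fin 3) (Fin 3) K} (hM : M.det ≠ 0) :
    ContinuousAt (fun M : Matrix (Fin 3) (Fin 3) K =>
      ((NNReal.sqrt (NNReal.sqrt (normAbs K M.charpoly.discr * ((normAbs K M.det) ^ 2)⁻¹)) : ℝ≥0) : ℝ≥0∞)⁻¹) M := by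
  have h1 : Continuous fun M : Matrix (Fin 3) (Fin 3) K => normAbs K M.charpoly.discr := LocalFieldHaar.continuous_normAbs.comp continuous_discr_charpoly
  have h2 : Continuous fun M : Matrix (Fin 3) (Fin 3) K => (normAbs K M.det) ^ 2 :=
    (LocalFieldHaar.continuous_normAbs.comp continuous_id.matrix_det).pow 2
  have h3 : ContinuousAt (fun M : Matrix (Fin 3) (Fin 3) K => ((normAbs K M.det) ^ 2)⁻¹) M :=
    h2.continuousAt.inv₀ (pow_ne_zero _ ((map_ne_zero (normAbs K)).2 hM))
  have h4 : ContinuousAt (fun M : Matrix (Fin 3) (Fin 3) K => normAbs K M.charpoly.discr * ((normAbs K M.det) ^ 2)⁻¹) M := h1.continuousAt.mul h3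
  exact continuous_inv.continuousAt.comp
    (ENNReal.continuous_coe.continuousAt.comp ((NNReal.continuous_sqrt.comp NNReal.continuous_sqrt).continuousAt.comp h4))

/-- At a singular matrix `θ = ⊤` (`x⁻¹ = 0` in `ℝ≥0`, so the radicand vanishes). [cite: Rogawski1990, §4.9 p. 54] -/
theorem theta_eq_top_of_det_eq_zero {M : Matrix (Fin 3) (Fin 3) K} (hM : M.det = 0) :
    ((NNReal.sqrt (NNReal.sqrt (normAbs K M.charpoly.discr * ((normAbs K M.det) ^ 2)⁻¹)) : ℝ≥0) : ℝ≥0∞)⁻¹ = ⊤ := by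
  rw [hM, map_zero, zero_pow two_ne_zero, _root_.inv_zero, mul_zero, NNReal.sqrt_zero, NNReal.sqrt_zero, ENNReal.coe_zero, ENNReal.inv_zero]

variable {G : Type*} [Group G] [TopologicalSpace G] (ρ : G →* GL (Fin 3) K)

/-- **`g ↦ θ(ρ g)` is continuous** (hence Borel) on `G` for `ρ` continuous (`det ρ g ≠ 0`). [cite: HarishChandra1970, Part VII §1 Thm. 15] -/
theorem continuous_theta_comp (hρc : Continuous ρ) :
    Continuous fun g : G =>
      ((NNReal.sqrt (NNReal.sqrt (normAbs K ((ρ g : GL (Fin 3) K) : Matrix (Fin 3) (Fin 3) K).charpoly.discr *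
        ((normAbs K ((ρ g : GL (Fin 3) K) : Matrix (Fin 3) (Fin 3) K).det) ^ 2)⁻¹)) : ℝ≥0) : ℝ≥0∞)⁻¹ := by
  have hM : Continuous fun g : G => ((ρ g : GL (Fin 3) K) : Matrix (Fin 3) (Fin 3) K) := Units.continuous_val.comp hρc
  rw [continuous_iff_continuousAt]
  intro g
  have hdet : ((ρ g : GL (Fin 3) K) : Matrix (Fin 3) (Fin 3) K).det ≠ 0 := by
    have h := (Matrix.GeneralLinearGroup.det (ρ g)).ne_zero
    rwa [Matrix.GeneralLinearGroup.val_det_apply] at h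
  exact ContinuousAt.comp (f := fun g : G => ((ρ g : GL (Fin 3) K) : Matrix (Fin 3) (Fin 3) K)) (x := g) (continuousAt_theta hdet)
    hM.continuousAt

variable (𝔲 : AddSubgroup (Matrix (Fin 3) (Fin 3) K)) [MeasurableSpace 𝔲] [BorelSpace 𝔲]

/-- **`s ↦ θ(z • c(X₀ + s))` is Borel on `𝔲`**: continuous on the open set where `1 ± (X₀ + s)` are invertible (`c = (1 + ·)(1 − ·)⁻¹`, matrix inversion is continuous
at invertible matrices), and identically `⊤` off it (there `c(X₀ + s)` is singular or junk `0`, so `det = 0`); Mathlib `ContinuousOn.measurable_piecewise`.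
[cite: PlatonovRapinchuk1994, §3.3] [cite: Rogawski1990, §4.9 p. 54] -/
theorem measurable_theta_smul_cayley {z : K} (hz : z ≠ 0) (X₀ : Matrix (Fin 3) (Fin 3) K) :
    Measurable fun s : 𝔲 =>
      ((NNReal.sqrt (NNReal.sqrt (normAbs K (z • cayley (X₀ + (s : Matrix (Fin 3) (Fin 3) K))).charpoly.discr *
        ((normAbs K (z • cayley (X₀ + (s : Matrix (Fin 3) (Fin 3) K))).det) ^ 2)⁻¹)) : ℝ≥0) : ℝ≥0∞)⁻¹ := by
  classical
  haveI : T2Space K := (isLocalField K).toT2Space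
  set θ : Matrix (Fin 3) (Fin 3) K → ℝ≥0∞ := fun M =>
    ((NNReal.sqrt (NNReal.sqrt (normAbs K M.charpoly.discr * ((normAbs K M.det) ^ 2)⁻¹)) : ℝ≥0) : ℝ≥0∞)⁻¹ with hθ
  set ψ : 𝔲 → Matrix (Fin 3) (Fin 3) K := fun s => z • cayley (X₀ + (s : Matrix (Fin 3) (Fin 3) K)) with hψ
  set O : Set 𝔲 := {s | (1 - (X₀ + (s : Matrix (Fin 3) (Fin 3) K))).det ≠ 0 ∧ (1 + (X₀ + (s : Matrix (Fin 3) (Fin 3) K))).det ≠ 0} with hO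
  have hco : Continuous fun s : 𝔲 => X₀ + (s : Matrix (Fin 3) (Fin 3) K) := continuous_const.add continuous_subtype_val
  have hOo : IsOpen O :=
    (isOpen_ne_fun ((continuous_const.sub hco).matrix_det) continuous_const).inter
      (isOpen_ne_fun ((continuous_const.add hco).matrix_det) continuous_const)
  -- off `O` the value is `⊤`
  have hoff : ∀ s, s ∉ O → θ (ψ s) = ⊤ := by
    intro s hs
    apply theta_eq_top_of_det_eq_zero
    simp only [hψ, Matrix.det_smul, cayley_def, Matrix.det_mul, Matrix.det_nonsing_inv, Ring.inverse_eq_inv']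
    rw [hO, Set.mem_setOf_eq, not_and_or, not_ne_iff, not_ne_iff] at hs
    rcases hs with h | h
    · rw [h, _root_.inv_zero, mul_zero, mul_zero]
    · rw [h, zero_mul, mul_zero]
  -- on `O` the map is continuous
  have hon : ContinuousOn (fun s => θ (ψ s)) O := by
    intro s hs
    have hdet1 : IsUnit (1 - (X₀ + (s : Matrix (Fin 3) (Fin 3) K))).det := isUnit_iff_ne_zero.2 hs.1
    have hψc : ContinuousAt ψ s := by
      have hinv : ContinuousAt Inv.inv (1 - (X₀ + (s : Matrix (Fin 3) (Fin 3) K))) := by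
        refine continuousAt_matrix_inv _ ?_
        rw [Ring.inverse_eq_inv']
        exact continuousAt_inv₀ hdet1.ne_zero
      have h1 : ContinuousAt (fun s : 𝔲 => (1 - (X₀ + (s : Matrix (Fin 3) (Fin 3) K)))⁻¹) s :=
        ContinuousAt.comp (f := fun s : 𝔲 => 1 - (X₀ + (s : Matrix (Fin 3) (Fin 3) K))) (x := s) hinv (continuous_const.sub hco).continuousAt
      have h2 : ContinuousAt (fun s : 𝔲 => (1 + (X₀ + (s : Matrix (Fin 3) (Fin 3) K))) * (1 - (X₀ + (s : Matrix (Fin 3) (Fin 3) K)))⁻¹) s :=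
        (continuous_const.add hco).continuousAt.mul h1
      have h3 : ContinuousAt (fun s : 𝔲 => z • ((1 + (X₀ + (s : Matrix (Fin 3) (Fin 3) K))) * (1 - (X₀ + (s : Matrix (Fin 3) (Fin 3) K)))⁻¹)) s :=
        ContinuousAt.comp (f := fun s : 𝔲 => (1 + (X₀ + (s : Matrix (Fin 3) (Fin 3) K))) * (1 - (X₀ + (s : Matrix (Fin 3) (Fin 3) K)))⁻¹) (x := s)
          (continuous_const_smul z).continuousAt h2
      simpa only [hψ, cayley_def] using h3
    have hdetψ : (ψ s).det ≠ 0 := by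
      simp only [hψ, Matrix.det_smul, cayley_def, Matrix.det_mul, Matrix.det_nonsing_inv, Ring.inverse_eq_inv']
      exact mul_ne_zero (pow_ne_zero _ hz) (mul_ne_zero hs.2 (inv_ne_zero hs.1))
    exact (ContinuousAt.comp (f := ψ) (x := s) (continuousAt_theta hdetψ) hψc).continuousWithinAt
  have heq : (fun s => θ (ψ s)) = O.piecewise (fun s => θ (ψ s)) (fun _ => ⊤) := by
    funext s
    by_cases hs : s ∈ O
    · rw [Set.piecewise_eq_of_mem _ _ _ hs]
    · rw [Set.piecewise_eq_of_notMem _ _ _ hs, hoff s hs]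
  show Measurable fun s => θ (ψ s)
  rw [heq]
  exact ContinuousOn.measurable_piecewise hon continuousOn_const hOo.measurableSet

end Measurable

/-! ## §4 HEAD: local integrability transfers from the Lie algebra to the group -/

section Head

variable {K : Type*} [Field K] [ValuativeRel K] [TopologicalSpace K] [IsNonarchimedeanLocalField K]
  (σ : K →+* K) (J : Matrix (Fin 3) (Fin 3) K) (𝔲 : AddSubgroup (Matrix (Fin 3) (Fin 3) K))
  [MeasurableSpace 𝔲] [BorelSpace 𝔲] (μ : Measure 𝔲) [μ.IsAddHaarMeasure]
  {G : Type*} [Group G] [TopologicalSpace G] [IsTopologicalGroup G] [LocallyCompactSpace G] [SecondCountableTopology G] [T2Space G]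
  [MeasurableSpace G] [BorelSpace G] (ρ : G →* GL (Fin 3) K) (ν : Measure G) [ν.IsHaarMeasure]

set_option maxHeartbeats 800000 in
-- the head threads ★ `exists_depth_lintegral_translate_eq` with the bound of §2 and one change of variables
/-- **(G→𝔤) — LOCAL INTEGRABILITY OF `|D_G|^{−1∕2}` FROM THE LIE ALGEBRA.**  In the setting of ★ `exists_depth_lintegral_translate_eq` (`K` non-archimedean local, `2 ≠ 0`,
`σ` continuous, `J` invertible, `𝔲 = {ᵗ(σX)J + JX = 0}` with additive Haar measure `μ`, `ρ : G →* GL₃(K)` inducing injective onto the unitary group, Haar `ν`, infinitely many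
norm-one scalars): IF every point `X₀ ∈ 𝔲` has a neighbourhood `U` with `∫⁻_U (↑√√|discr χ_X|)⁻¹ dμ < ∞` (the R2 token `ηι`), THEN every `g₀ ∈ G` has a neighbourhood `U`
with **`∫⁻_U (↑√√(|discr χ_{ρ g}| · |det ρ g|⁻²))⁻¹ dν(g) < ∞`** (the R2 token `θ`, one place of RUNG0's `hDGliO`).  Proof: ★ (D6a)+(D6c) give `U = g₀ • c(Λ_k)` with
`∫⁻_U θ(ρ g) dν = κ ∫⁻_{Λ_k} θ(z • c(X₀ + L̃ Y)) dμ`; §2 bounds the integrand by `C* · ηι(X₀ + L̃ Y)` on the compact `Λ_k`; `Y ↦ X₀ + L̃ Y` maps `μ` to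
`(addEquivAddHaarChar L̃)⁻¹ • μ` (translation invariance + Mathlib's Haar character), and `Λ_k` was shrunk into the given neighbourhood of `X₀`.
[cite: HarishChandra1970, Part VII §1 Thm. 15] [cite: Rogawski1990, §12.5 p. 182] [cite: PlatonovRapinchuk1994, §3.3] -/
theorem exists_nhds_setLIntegral_theta_lt_top (hσc : Continuous σ) (h2 : (2 : K) ≠ 0) (hJ : IsUnit J.det)
    (h𝔲 : ∀ X, X ∈ 𝔲 ↔ (X.map σ)ᵀ * J + J * X = 0)
    (hρ : IsInducing ρ) (hρinj : Function.Injective ρ)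
    (hρr : ∀ g : GL (Fin 3) K, g ∈ Set.range ρ ↔ (((g : Matrix (Fin 3) (Fin 3) K)).map σ)ᵀ * J * (g : Matrix (Fin 3) (Fin 3) K) = J)
    (hE : {z : K | σ z * z = 1}.Infinite)
    (hLie : ∀ X₀ : 𝔲, ∃ U ∈ 𝓝 X₀, ∫⁻ X in U,
      ((NNReal.sqrt (NNReal.sqrt (normAbs K (X : Matrix (Fin 3) (Fin 3) K).charpoly.discr)) : ℝ≥0) : ℝ≥0∞)⁻¹ ∂μ < ∞)
    (g₀ : G) :
    ∃ U ∈ 𝓝 g₀, ∫⁻ g in U,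
      ((NNReal.sqrt (NNReal.sqrt (normAbs K ((ρ g : GL (Fin 3) K) : Matrix (Fin 3) (Fin 3) K).charpoly.discr *
        ((normAbs K ((ρ g : GL (Fin 3) K) : Matrix (Fin 3) (Fin 3) K).det) ^ 2)⁻¹)) : ℝ≥0) : ℝ≥0∞)⁻¹ ∂ν < ∞ := by
  classical
  -- instances on `𝔲` (closed in the locally compact, second countable, metrisable `M₃(K)`)
  haveI : T2Space K := (isLocalField K).toT2Space
  haveI : SecondCountableTopology K := secondCountableTopology_localField K
  haveI : TopologicalSpace.PseudoMetrizableSpace K := pseudoMetrizableSpace_localField K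
  haveI : LocallyCompactSpace (Matrix (Fin 3) (Fin 3) K) := inferInstanceAs (LocallyCompactSpace (Fin 3 → Fin 3 → K))
  haveI : SecondCountableTopology (Matrix (Fin 3) (Fin 3) K) := inferInstanceAs (SecondCountableTopology (Fin 3 → Fin 3 → K))
  haveI : TopologicalSpace.PseudoMetrizableSpace (Matrix (Fin 3) (Fin 3) K) :=
    inferInstanceAs (TopologicalSpace.PseudoMetrizableSpace (Fin 3 → Fin 3 → K))
  haveI : LocallyCompactSpace 𝔲 := (isClosedEmbedding_subtype σ J 𝔲 hσc h𝔲).locallyCompactSpace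
  haveI : SecondCountableTopology 𝔲 := TopologicalSpace.Subtype.secondCountableTopology _
  haveI : SigmaCompactSpace 𝔲 := sigmaCompactSpace_of_locallyCompact_secondCountable
  haveI : μ.Regular := inferInstance
  -- the two integrands as functions
  set θ : Matrix (Fin 3) (Fin 3) K → ℝ≥0∞ := fun M =>
    ((NNReal.sqrt (NNReal.sqrt (normAbs K M.charpoly.discr * ((normAbs K M.det) ^ 2)⁻¹)) : ℝ≥0) : ℝ≥0∞)⁻¹ with hθ
  set ηι : 𝔲 → ℝ≥0∞ := fun X => ((NNReal.sqrt (NNReal.sqrt (normAbs K (X : Matrix (Fin 3) (Fin 3) K).charpoly.discr)) : ℝ≥0) : ℝ≥0∞)⁻¹ with hηι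
  -- ★ (D6a)+(D6c)
  obtain ⟨z, X₀, LS, Λ, k₀, hz1, hz0, hX₀, hm, hp, hg₀, hLS, hΛo, hΛc, hΛanti, hΛbasis, hk⟩ :=
    exists_depth_lintegral_translate_eq σ J 𝔲 μ ρ ν hσc h2 hJ h𝔲 hρ hρinj hρr hE g₀
  -- the neighbourhood of `X₀` on the Lie side, an open part of it, and a depth inside it
  obtain ⟨UL, hUL, hint⟩ := hLie ⟨X₀, hX₀⟩
  obtain ⟨V, hVU, hVo, hXV⟩ := mem_nhds_iff.1 hUL
  set T : 𝔲 → 𝔲 := fun Y => ⟨X₀, hX₀⟩ + LS Y with hT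
  have hTc : Continuous T := continuous_const.add LS.continuous
  have hT0 : T 0 = ⟨X₀, hX₀⟩ := by rw [hT]; simp
  have hpre : T ⁻¹' V ∈ 𝓝 (0 : 𝔲) := hTc.continuousAt.preimage_mem_nhds (by rw [hT0]; exact hVo.mem_nhds hXV)
  obtain ⟨k₃, hk₃⟩ := hΛbasis _ hpre
  set k := max k₀ k₃ with hkdef
  obtain ⟨hgoodk, U, hUo, hg₀U, κ, hκ0, hκt, hId⟩ := hk k (le_max_left _ _)
  have hΛkV : (Λ k : Set 𝔲) ⊆ T ⁻¹' V := fun Y hY => hk₃ (hΛanti (le_max_right _ _) hY)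
  refine ⟨U, hUo.mem_nhds hg₀U, ?_⟩
  -- the identity of ★ (D6a)+(D6c) for `H := θ`
  have hρc : Continuous ρ := hρ.continuous
  have hH₁ : Measurable fun g : G => θ ((ρ g : GL (Fin 3) K) : Matrix (Fin 3) (Fin 3) K) := (continuous_theta_comp ρ hρc).measurable
  have hH₂ : Measurable fun s : 𝔲 => θ (z • cayley (X₀ + (s : Matrix (Fin 3) (Fin 3) K))) := measurable_theta_smul_cayley 𝔲 hz0 X₀
  have hId' := hId θ hH₁ hH₂
  simp only [hθ] at hId' ⊢
  rw [hId']
  -- pointwise bound on `Λ k` by `C* · ηι (T Y)`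
  have hcont : Continuous fun Y : 𝔲 =>
      normAbs K ((1 - (X₀ + ((LS Y : 𝔲) : Matrix (Fin 3) (Fin 3) K))).det * (1 + (X₀ + ((LS Y : 𝔲) : Matrix (Fin 3) (Fin 3) K))).det) := by
    have hc : Continuous fun Y : 𝔲 => X₀ + ((LS Y : 𝔲) : Matrix (Fin 3) (Fin 3) K) :=
      continuous_const.add (continuous_subtype_val.comp LS.continuous)
    exact LocalFieldHaar.continuous_normAbs.comp (((continuous_const.sub hc).matrix_det).mul ((continuous_const.add hc).matrix_det))
  obtain ⟨B, hB⟩ := (hΛc k).bddAbove_image hcont.continuousOn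
  set Cst : ℝ≥0 := NNReal.sqrt B / NNReal.sqrt (normAbs K 2) ^ 3 with hCst
  have hbound : ∀ Y ∈ (Λ k : Set 𝔲),
      ((NNReal.sqrt (NNReal.sqrt (normAbs K (z • cayley (X₀ + ((LS Y : 𝔲) : Matrix (Fin 3) (Fin 3) K))).charpoly.discr *
        ((normAbs K (z • cayley (X₀ + ((LS Y : 𝔲) : Matrix (Fin 3) (Fin 3) K))).det) ^ 2)⁻¹)) : ℝ≥0) : ℝ≥0∞)⁻¹ ≤ (Cst : ℝ≥0∞) * ηι (T Y) := by
    intro Y hY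
    obtain ⟨hm', hp'⟩ := hgoodk Y hY
    refine (theta_smul_cayley_le h2 hz0 hm' hp').trans ?_
    have hTY : ((T Y : 𝔲) : Matrix (Fin 3) (Fin 3) K) = X₀ + ((LS Y : 𝔲) : Matrix (Fin 3) (Fin 3) K) := by rw [hT]; simp
    rw [hηι]; dsimp only; rw [hTY]
    refine mul_le_mul_of_nonneg_right ?_ zero_le
    rw [ENNReal.coe_le_coe, hCst]
    exact div_le_div_of_nonneg_right (NNReal.sqrt_le_sqrt.2 (hB ⟨Y, hY, rfl⟩)) (pow_pos (NNReal.sqrt_pos.2 (pos_iff_ne_zero.2 ((map_ne_zero (normAbs K)).2 h2))) 3).le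
      |>.trans le_rfl
  -- integrate the bound
  have hstep1 : ∫⁻ Y in (Λ k : Set 𝔲),
      ((NNReal.sqrt (NNReal.sqrt (normAbs K (z • cayley (X₀ + ((LS Y : 𝔲) : Matrix (Fin 3) (Fin 3) K))).charpoly.discr *
        ((normAbs K (z • cayley (X₀ + ((LS Y : 𝔲) : Matrix (Fin 3) (Fin 3) K))).det) ^ 2)⁻¹)) : ℝ≥0) : ℝ≥0∞)⁻¹ ∂μ ≤
      (Cst : ℝ≥0∞) * ∫⁻ Y in (Λ k : Set 𝔲), ηι (T Y) ∂μ := by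
    rw [← lintegral_const_mul' _ _ ENNReal.coe_ne_top]
    exact setLIntegral_mono' (hΛo k).measurableSet fun Y hY => hbound Y hY
  -- change of variables `Y ↦ T Y = X₀ + L̃ Y`: `μ.map T = (addEquivAddHaarChar L̃)⁻¹ • μ`
  have hstep2 : ∫⁻ Y in (Λ k : Set 𝔲), ηι (T Y) ∂μ ≤ ((addEquivAddHaarChar LS)⁻¹ : ℝ≥0) * ∫⁻ X in V, ηι X ∂μ := by
    have hTm : Measurable T := hTc.measurable
    let e : 𝔲 ≃ᵐ 𝔲 := (LS.toHomeomorph.trans (Homeomorph.addLeft (⟨X₀, hX₀⟩ : 𝔲))).toMeasurableEquiv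
    have he : (e : 𝔲 → 𝔲) = T := by
      funext Y; rw [hT]; rfl
    have hmapLS : μ.map LS = ((addEquivAddHaarChar LS)⁻¹ : ℝ≥0) • μ := by
      have h := addEquivAddHaarChar_smul_map μ LS
      rw [← h, smul_smul, inv_mul_cancel₀ (addEquivAddHaarChar_pos LS).ne', one_smul, h]
    have hmapT : μ.map T = ((addEquivAddHaarChar LS)⁻¹ : ℝ≥0) • μ := by
      have : T = (fun Y : 𝔲 => (⟨X₀, hX₀⟩ : 𝔲) + Y) ∘ LS := by funext Y; rfl
      have hLSm : Measurable (LS : 𝔲 → 𝔲) := LS.continuous.measurable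
      rw [this, ← Measure.map_map (measurable_const_add _) hLSm]
      change Measure.map (fun Y : 𝔲 => (⟨X₀, hX₀⟩ : 𝔲) + Y) (μ.map LS) = _
      rw [hmapLS, Measure.map_smul, map_add_left_eq_self]
    calc ∫⁻ Y in (Λ k : Set 𝔲), ηι (T Y) ∂μ ≤ ∫⁻ Y in T ⁻¹' V, ηι (T Y) ∂μ := lintegral_mono_set hΛkV
      _ = ∫⁻ X in V, ηι X ∂(μ.map T) := by
          rw [← he, MeasurableEquiv.restrict_map, lintegral_map_equiv]
      _ = ((addEquivAddHaarChar LS)⁻¹ : ℝ≥0) * ∫⁻ X in V, ηι X ∂μ := by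
          rw [hmapT, Measure.restrict_smul, lintegral_smul_measure, ENNReal.smul_def, smul_eq_mul]
  have hfinV : ∫⁻ X in V, ηι X ∂μ < ∞ := lt_of_le_of_lt (lintegral_mono_set hVU) hint
  refine ENNReal.mul_lt_top (lt_top_iff_ne_top.2 hκt) ?_
  refine lt_of_le_of_lt hstep1 (ENNReal.mul_lt_top ENNReal.coe_lt_top ?_)
  exact lt_of_le_of_lt hstep2 (ENNReal.mul_lt_top ENNReal.coe_lt_top hfinV)

end Head

end Summit.HodgeConjecture.HodgeConjecture.Cruxes.H413.F0P3cStCharTSHCDGroupToLie
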